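import Summits.BirchSwinnertonDyer.BirchSwinnertonDyer.Theses.PrintX10b
import Summits.BirchSwinnertonDyer.BirchSwinnertonDyer.Theorems.PrintX10bUntiedHowardContainmentOfPrintCore
import Summits.BirchSwinnertonDyer.BirchSwinnertonDyer.Theorems.PrintX10bHowardContainmentAnyClassNumberX10bThm413Hyp
import Literature.NumberTheory.EllipticCurves.HeegnerStabilizedClassNonvanishingProofs
import Literature.NumberTheory.EllipticCurves.LambdaAdicSelmerDataTorsionFreeProofs
import Literature.NumberTheory.EllipticCurves.HeegnerCharIdealScalingTransferProofs
import HarnessLib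

/-!
# `HowardContainmentAnyClassNumberX10b` (stmt-BirchSwinnertonDyer-23729): the PARITY-FREE core modulo Cornut–Vatsal
# 2007 Thm. 1.10, and the census of the ONE residual `R_even` (even `d_K`, `3 ∣ h_K`) as «CGS 2025 Thm. 6.5.2's
# conclusion on those frames» — the (disc) dependence of the whole glue isolated in ONE printed theorem's scope

Cell `pub/bsd-print-x9`, seat `bsd-line-x10b-p2` (LEAD g12), write-crux stmt-BirchSwinnertonDyer-23729
`PrintX10b.HowardContainmentAnyClassNumberX10b` (OPEN·aside, frozen; PIN-1 / R0). THEOREMS ONLY (`--supports 23729`);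
no definition, no named fact, no `sorry`, no instance.

STATE BEFORE THIS FILE (LEAD g11, p690868 + skeleton v2 `Cruxes/…/Lines/torsion_depth_x10b.lean`): the crux BY NAME
⟸ the cite-only leaves `CGLSHeegnerKolyvaginSystem` (23236) + `CGSHowardDivisibilityPLocalized` (27112) +
`MastellaZermanHowardDivisibility` (25233) + `R_even` := the crux's OWN conclusion on the frames with `d_K` even (`≠ -4`)
and `3 ∣ h_K` («no printed source»). Every landed glue step was keyed on `CastellaGrossiLeeSkinner2022.Thm413Hypotheses`,
whose field `discr_odd : Odd (NumberField.discr K)` is CGLS 2022's §4.1 standing (disc) — so on even-`d_K` frames nothing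
of the odd-`d_K` proof could be replayed, and the residual had to be the crux itself.

WHAT THIS FILE SHOWS (kernel): (disc) enters the odd-`d_K` proof ONLY through the two leaf records. Precisely:

* §0 `discr_lt_neg_four_of_ne`, `card_ringClassGalOver_prime_one_of_discr_lt` — the one glue input that was fed by
  `discr_odd` (the ring-class degree `[K[p] : K[1]] = p − 1`, `card_ringClassGalOver_prime_one_of_frame`) needs only
  `d_K < -4`, which holds on EVERY frame of the crux (`d_K ≠ -3, -4`; Minkowski `|d_K| > 2`), odd or even.
* §1 **`howardContainment_untied_localized_of_thm110_of_cgs652At`** / **`howardContainment_untied_of_thm110_of_cgs652At`**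
  — the PARITY-FREE, CLASS-FREE, route-free core: on a frame given FIELD BY FIELD (`E` elliptic, `p ≠ 2` good ordinary,
  `p ∤ N_E`, `K` imaginary quadratic with `d_K < -4`, (Heeg) for `N_E` and for `p`, (h1) `E(K)[p] = 0`, `κ`
  anticyclotomic with topological generator `γ`) and for given `jbar`, `Dt`, `H`: GRANTED Cornut–Vatsal 2007 Thm. 1.10
  (`hCV`, the tree's statement-only leaf `CornutVatsal2007.thm110_exists_heegnerCharSum_ne_zero` — NO parity, NO
  class-number binder) and GRANTED the CONCLUSION of CGS 2025 Thm. 6.5.2 AT THIS FRAME (`h652At : ∀ D C X, …`, the body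
  of `CastellaGrossiSkinner2025.thm652_stabilized_rankOne_charIdeal_torsion_dvd_pLocalized` verbatim), there are `D`, a
  Heegner family `F` and `X` with `I(ℋ_∞(F))² ⊆ char_Λ(X_{Λ-tors})`. Proof = the x9-p1-w2 g14 Cornut–Vatsal road
  (`exists_coherent_pair_envelope_ne_bot_of_thm110`: coherent pair ON `(Dt, H.β)` with `Λκ_∞(C) ≠ ⊥`; torsion of
  `𝔖/Λκ_∞(C)` by rank–nullity from `rank_Λ 𝔖 = 1` and torsion-freeness `noZeroSMulDivisors_of_noPTorsion`; envelopes;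
  μ-blind promotion `PrintX9Rescaling.howardContainment_of_localized_family`) — verbatim, with the record replaced by its
  fields and `discr_odd` by `d_K < -4`.
* §2 **`howardContainmentAnyClassNumberX10b_at_of_thm110_of_cgs652At`** — the same on ANY X10b Heegner frame of 23729
  (fields = theorems on class X10b: `ClassX10.ne_two/.isOrdinaryAt/.not_dvd_conductorNorm`, (h1), §0 for `d_K < -4`).
* §3 THE CENSUS:
  - **`stub_evenDisc_divisibleClassNumber_of_thm110_of_cgs652OnEvenFrames`** — skeleton v2's residual stub `R_even` (text
    verbatim) ⟸ `hCV` + «Thm. 6.5.2 (i)–(ii) on the `R_even` frames» (binders of the stub verbatim incl. `¬ Odd d_K`,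
    `p ∣ h_K`, then `∀ jbar D C X`, the body of the typed fact) — so p690868's census runs with `R_even` so replaced;
  - `cgs652OnFrames_oddDisc_of_cgs` — on ODD-`d_K` frames the frame-local hypothesis IS the leaf 27112 (kernel check that
    the new hypothesis differs from typed print on the even-`d_K` frames only);
  - **`howardContainmentAnyClassNumberX10b_of_cgs_mz_of_thm110_of_cgs652OnEvenFrames :
    CGSHowardDivisibilityPLocalized → MastellaZermanHowardDivisibility → hCV → CGS652^{R_even} → 23729`** — the crux BY NAME
    from the typed leaves 27112 + 25233, Cornut–Vatsal Thm. 1.10 and Thm. 6.5.2's conclusion on the `R_even` frames only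
    (= p690868's census with the Kolyvagin-system leaf 23236 replaced by Cornut–Vatsal and `R_even` by that conclusion).

WHY IT MATTERS (census). The typed leaf 27112 carries (disc) because the literature seat imported CGLS 2022 §4.1's standing
hypotheses into `Thm413Hypotheses` (`κ^{Hg}` "of [CGLS22, Thm. 4.1.1]" is built there). The PRINTED Castella–Grossi–Skinner,
Math. Ann. 393 (2025) Thm. 6.5.2 (= arXiv:2303.04373v1 Thm. 5.5.2, p. 26) reads "Assume `E(K)[p] = 0`. Then …" under the §6
standing hypotheses (`E/ℚ` of conductor `N`, `p ∤ 2N` good ordinary, `D_K` prime to `Np`) — no (disc); (Heeg), (spl), (disc)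
appear first in Thm. 6.5.3 / Cor. 6.5.4.
Whether Thm. 6.5.2 may be cited on even-`d_K` frames is therefore a READING question on one printed theorem (pen / lit /
referee desks), no longer a search for an unprinted statement: after this file the residual of 23729 is exactly «CGS 2025
Thm. 6.5.2 (i)–(ii) on the X10b Heegner frames with `d_K` even (`≠ -4`) and `3 ∣ h_K`», with Cornut–Vatsal Thm. 1.10
(published, parity-free) as the only other input; (disc) is idle in the construction of `κ^{Hg}` and in Cornut–Vatsal.

HONEST FRAMING. (i) Kernel-valid AS TYPED and CONDITIONAL on `hCV` (statement-only Literature leaf) and on the frame-local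
hypothesis `h652At` / `CGS652^{…}` — a HYPOTHESIS, not a Literature fact, equal to the typed leaf on odd `d_K` only (§3);
(ii) PIN-1 / R0 stand (`F := p^m • F₀` is a rescaled family): not route currency, no `closes` changes; (iii) 23729 AS FILED
stays open. «beyond-print theorem»: no. No summit statement is proved; BSD is NOT proved by any of this.

References: [CastellaGrossiSkinner2025] Thm. 6.5.1/6.5.2, §6 standing (arXiv:2303.04373v1 §5.5 p. 26); [CastellaGrossiLeeSkinner2022]
Thm. 4.1.1, Rem. 4.1.4, §4.1 (Heeg)+(disc) (arXiv:2008.02571v2 TeX L2186, L248–249); [CornutVatsal2007] Thm. 1.10;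
[Howard2004HeegnerKolyvagin] §3.3, Thm. B; [PerrinRiou1987BSMF] §1 p. 405, §3.4 Prop. 10; [Cox2013] Thm. 7.24, Cor. 7.28.
-/

set_option linter.dupNamespace false
set_option autoImplicit false
noncomputable section
open scoped Classical Pointwise
open Literature Literature.NumberTheory.EllipticCurves WeierstrassCurve
  Literature.NumberTheory.EllipticCurves.ModularForms
  Literature.NumberTheory.EllipticCurves.CastellaGrossiLeeSkinner2022
open Literature.NumberTheory.EllipticCurves.Rank1Residual (ClassX10 Surj)
open Summit.BirchSwinnertonDyer.BirchSwinnertonDyer.Theses.PrintX10b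
open Summit.BirchSwinnertonDyer.BirchSwinnertonDyer.Theorems

namespace Summit.BirchSwinnertonDyer.BirchSwinnertonDyer.Theorems.PrintX10bEvenDiscOfCornutVatsal

/-! ## §0 Bookkeeping: `d_K < -4` on every frame of the crux, and the ring-class degree `[K[p] : K[1]] = p − 1` from it -/

/-- Ideal bookkeeping: `(a) · ((b) · I)² = (a·b²) · I²`. [folklore] -/
private theorem span_singleton_mul_sq {R : Type*} [CommSemiring R] (a b : R) (I : Ideal R) :
    Ideal.span {a} * (Ideal.span {b} * I) ^ 2 = Ideal.span {a * b ^ 2} * I ^ 2 := by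
  rw [mul_pow, Ideal.span_singleton_pow, ← mul_assoc, Ideal.span_singleton_mul_span_singleton]

/-- **`d_K < -4` on every Heegner frame of the crux** (`K` imaginary quadratic, `d_K ≠ -3`, `d_K ≠ -4`), with NO parity
input: `|d_K| > 2` by Minkowski (Mathlib `NumberField.abs_discr_gt_two`), so `d_K ≤ -5`. Replaces
`IsImaginaryQuadratic.discr_lt_neg_four_of_odd` (which reads `d_K` odd) in the glue. [cite: Cox2013, Thm. 7.24] -/
theorem discr_lt_neg_four_of_ne {K : Type} [Field K] [NumberField K] (hK : IsImaginaryQuadratic K)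
    (h3 : NumberField.discr K ≠ -3) (h4 : NumberField.discr K ≠ -4) : NumberField.discr K < -4 := by
  have hgt : 2 < |NumberField.discr K| := NumberField.abs_discr_gt_two (by rw [hK.1]; exact one_lt_two)
  have hneg : NumberField.discr K < 0 := hK.discr_neg
  rw [abs_of_neg hneg] at hgt
  omega

/-- **`[K[p] : K[1]] = p − 1` at a prime `p` split in `K` whenever `d_K < -4`** (the unit index `[𝒪_K^× : 𝒪_p^×]` is
`1`): the tree's `HeegnerTraceSplit.card_ringClassGalOver_eq_of_split` at `m = 1` through its `d_K < -4` branch — the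
parity-free form of `card_ringClassGalOver_prime_one_of_frame`. [cite: Cox2013, Thm. 7.24 and Cor. 7.28]
[cite: Darmon2004, Prop. 3.10 (proof, p. 36: #Gal(H_{nℓ}/H_n) = ℓ − 1 at a split ℓ)] -/
theorem card_ringClassGalOver_prime_one_of_discr_lt {K : Type} [Field K] [NumberField K]
    (hK : IsImaginaryQuadratic K) (hlt : NumberField.discr K < -4) {p : ℕ} (hp : p.Prime)
    (hHp : SatisfiesHeegnerHypothesis p K) (jbar : AlgebraicClosure K →+* ℂ) :
    Nat.card (ringClassGalOver (jbar.comp (algebraMap K (AlgebraicClosure K))) p 1) = p - 1 := by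
  have hsplit : ((Ideal.span {(p : ℤ)}).primesOver (NumberField.RingOfIntegers K)).ncard = 2 := hHp p hp dvd_rfl
  have h := HeegnerTraceSplit.card_ringClassGalOver_eq_of_split hK (jbar.comp (algebraMap K (AlgebraicClosure K)))
    (m := 1) hp hsplit hp.not_dvd_one one_ne_zero (Or.inr hlt)
  rw [mul_one] at h
  exact h

/-- **Rank–nullity at `Λ`-rank one** (route-free copy of the x9-p2 bookkeeping
`PrintX9Binders.noZeroSMulDivisors_and_isTorsion_quotient_of_finrank_eq_one`, second conjunct): `𝔖_p(K_∞)` is torsion-free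
when `E(K)[p] = 0` (`LambdaAdicSelmerData.noZeroSMulDivisors_of_noPTorsion`), so for `𝔖` finitely generated of `Λ`-rank
one and `L ≠ ⊥` the quotient `𝔖 ⧸ L` is `Λ`-torsion. [cite: PerrinRiou1987BSMF, §1 p. 405 (I(H_∞) ≠ 0 iff rank 1)]
[cite: CastellaGrossiLeeSkinner2022, §3.3 (torsion-freeness of H¹(K,𝐓) under (h1))] -/
theorem isTorsion_quotient_of_finrank_eq_one_of_ne_bot {K : Type} [Field K] [NumberField K]
    {V : WeierstrassCurve K} [V.IsElliptic] {p : ℕ} [Fact p.Prime] {κ : ZpExtension K p}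
    {γ : Field.absoluteGaloisGroup K} (D : V.LambdaAdicSelmerData κ γ) (hγ : κ.IsTopGenerator γ)
    (hE : ∀ P : V.toAffine.Point, p • P = 0 → P = 0) [Module.Finite (IwasawaAlgebra p) D.S]
    (h1 : Module.finrank (IwasawaAlgebra p) D.S = 1) {L : Submodule (IwasawaAlgebra p) D.S} (hL : L ≠ ⊥) :
    Module.IsTorsion (IwasawaAlgebra p) (D.S ⧸ L) := by
  obtain ⟨z, hzL, hz0⟩ := (Submodule.ne_bot_iff L).mp hL
  have hz : ∀ b : IwasawaAlgebra p, b • z = 0 → b = 0 := fun b hb ↦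
    by_contra fun hb0 ↦ D.forall_smul_ne_zero_of_ne_zero' hγ hE hz0 b hb0 hb
  have htor := Module.isTorsion_quotient_span_singleton_of_torsionFree_of_finrank_eq_one (p := p) h1 hz
  refine Module.isTorsion_quotient_of_isTorsion_quotient_of_smul_le htor (one_ne_zero (α := IwasawaAlgebra p)) ?_
  rw [one_smul]
  exact (Submodule.span_singleton_le_iff_mem z L).mpr hzL

/-! ## §1 The PARITY-FREE core: untied containment from Cornut–Vatsal Thm. 1.10 and Thm. 6.5.2's conclusion AT the frame -/

/-- **The `p`-localized untied Howard containment, parity-free and class-free, for a given `jbar`**, from Cornut–Vatsal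
2007 Thm. 1.10 (`hCV`) and the CONCLUSION of CGS 2025 Thm. 6.5.2 at the frame (`h652At`, the body of the typed fact
`CastellaGrossiSkinner2025.thm652_stabilized_rankOne_charIdeal_torsion_dvd_pLocalized` for all `D C X` at this
`(W, K, p, κ, γ, jbar)`): on a frame given field by field — `p ≠ 2` good ordinary, `p ∤ N_E`, `K` imaginary quadratic
with `d_K < -4`, (Heeg) for `N_E` and for `p`, (h1) `E(K)[p] = 0`, `κ` anticyclotomic with topological generator `γ` —
there are `D`, a Heegner family `F` ON `(Dt, H.β)`, `X` and `m` with `𝔖` finitely generated of `Λ`-rank one,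
`𝔖/ℋ_∞(F)` torsion and `(p^m) · I(ℋ_∞(F))² ⊆ char_Λ(X_{Λ-tors})`. The coherent pair `(C, F)` with `Λκ_∞(C) ≠ ⊥` is
`exists_coherent_pair_envelope_ne_bot_of_thm110` (tower input = the theorem `anticyclotomicTowerSharp`, degree input
§0); torsion of `𝔖/Λκ_∞(C)` is rank–nullity (§0) on Thm. 6.5.2 (i); then the envelopes and Thm. 6.5.2 (ii).
NO `Odd d_K`, NO class-number, NO image, NO rank binder.
[cite: CornutVatsal2007, Thm. 1.10] [cite: CastellaGrossiSkinner2025, Thm. 6.5.2 (i)–(ii)]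
[cite: CastellaGrossiLeeSkinner2022, Rem. 4.1.4 (Λκ_∞ = Λκ₁^{Hg})] [cite: PerrinRiou1987BSMF, §1 p. 405, §3.4 Prop. 10] -/
theorem howardContainment_untied_localized_of_thm110_of_cgs652At
    (hCV : CornutVatsal2007.thm110_exists_heegnerCharSum_ne_zero)
    {W : WeierstrassCurve ℚ} [W.IsElliptic] [W.IsGloballyMinimal] [NeZero (W.conductorNorm ℤ)] {p : ℕ} [Fact p.Prime]
    {K : Type} [Field K] [NumberField K] {κ : ZpExtension K p} {γ : Field.absoluteGaloisGroup K}
    (hp2 : p ≠ 2) (hord : IsOrdinaryAt W p) (hpN : ¬ p ∣ W.conductorNorm ℤ)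
    (hK : IsImaginaryQuadratic K) (hlt : NumberField.discr K < -4)
    (hHN : SatisfiesHeegnerHypothesis (W.conductorNorm ℤ) K) (hHp : SatisfiesHeegnerHypothesis p K)
    (hE : ∀ Q : (W.baseChange K).toAffine.Point, p • Q = 0 → Q = 0)
    (hκ : κ.IsAnticyclotomic) (hγ : κ.IsTopGenerator γ) (jbar : AlgebraicClosure K →+* ℂ)
    (Dt : ModularParametrizationData W (W.conductorNorm ℤ)) (H : HeegnerDatum (W.conductorNorm ℤ) (NumberField.discr K))
    (h652At : ∀ (D : (W.baseChange K).LambdaAdicSelmerData κ γ)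
      (C : StabilizedHeegnerData (W.conductorNorm ℤ) W K κ jbar) (X : (W.baseChange K).SelmerDualData κ γ),
      (Module.Finite (IwasawaAlgebra p) D.S ∧ Module.finrank (IwasawaAlgebra p) D.S = 1) ∧
      (Module.Finite (IwasawaAlgebra p) X.X ∧ Module.finrank (IwasawaAlgebra p) X.X = 1 ∧
        ∃ (J : Ideal (IwasawaAlgebra p)) (m : ℕ),
          Module.charIdeal (IwasawaAlgebra p) (Submodule.torsion (IwasawaAlgebra p) X.X) = J ^ 2 ∧
          J ∣ Ideal.span {(p : IwasawaAlgebra p) ^ m} * stabilizedHeegnerCharIdeal D C)) :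
    ∃ (D : (W.baseChange K).LambdaAdicSelmerData κ γ) (F : HeegnerFamily (W.conductorNorm ℤ) W K κ jbar)
      (X : (W.baseChange K).SelmerDualData κ γ) (m : ℕ),
      F.Dt = Dt ∧ F.β = H.β ∧
      Module.Finite (IwasawaAlgebra p) D.S ∧ Module.finrank (IwasawaAlgebra p) D.S = 1 ∧
      Module.IsTorsion (IwasawaAlgebra p) (D.S ⧸ heegnerModule D F) ∧
      Ideal.span {((p : IwasawaAlgebra p) ^ m)} * heegnerCharIdeal D F ^ 2 ≤
        Module.charIdeal (IwasawaAlgebra p) (Submodule.torsion (IwasawaAlgebra p) X.X) := by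
  have hp : p.Prime := Fact.out
  have hp_odd : Odd p := hp.odd_of_ne_two hp2
  -- the data `𝔖`, `X`
  obtain ⟨D⟩ := LambdaAdicSelmerDataExists.nonempty_lambdaAdicSelmerData (W.baseChange K) p κ hγ
  obtain ⟨X⟩ := (W.baseChange K).nonempty_selmerDualData_holds κ γ hγ
  -- the coherent pair on `(Dt, H.β)` with its module-level envelope AND `Λκ_∞(C) ≠ ⊥` (Cornut–Vatsal)
  obtain ⟨C, F, -, hFDt, -, hFβ, hfwd, ⟨g, hg, hrev⟩, hne⟩ :=
    exists_coherent_pair_envelope_ne_bot_of_thm110 (W := W) hCV hK hHN Dt H.dvd_sq_sub jbar hord hpN κ hκ hγ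
      (fun k ↦ anticyclotomicTowerSharp K p hp_odd hK κ hκ jbar k)
      (card_ringClassGalOver_prime_one_of_discr_lt hK hlt hp hHp jbar) hE D
  have hfwd' : ((p : IwasawaAlgebra p) ^ 0) • heegnerModule D F ≤ stabilizedHeegnerModule D C := by
    rw [pow_zero, one_smul]
    exact hfwd
  -- Thm. 6.5.2 at the frame: `𝔖` f.g. of `Λ`-rank one, `char(X_tors) = J²`, `J ∣ (p^m)·I(Λκ_∞(C))`
  obtain ⟨⟨hSfin, hS1⟩, -, -, J, m, hJ, hdvd⟩ := h652At D C X
  haveI : Module.Finite (IwasawaAlgebra p) D.S := hSfin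
  have hm : Ideal.span {((p : IwasawaAlgebra p) ^ (m * 2))} * stabilizedHeegnerCharIdeal D C ^ 2 ≤
      Module.charIdeal (IwasawaAlgebra p) (Submodule.torsion (IwasawaAlgebra p) X.X) := by
    have h2 := pow_dvd_pow_of_dvd hdvd 2
    rw [mul_pow, Ideal.span_singleton_pow, ← pow_mul, ← hJ] at h2
    exact Ideal.le_of_dvd h2
  -- torsion of `𝔖/Λκ_∞(C)` by rank–nullity (torsion-free `𝔖` of rank one, `Λκ_∞(C) ≠ ⊥`), moved along the reverse envelope
  have htorC : Module.IsTorsion (IwasawaAlgebra p) (D.S ⧸ stabilizedHeegnerModule D C) :=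
    isTorsion_quotient_of_finrank_eq_one_of_ne_bot D hγ hE hS1 hne
  have htorF : Module.IsTorsion (IwasawaAlgebra p) (D.S ⧸ heegnerModule D F) :=
    isTorsion_quotient_heegnerModule_of_smul_stabilizedHeegnerModule_le D F C hg hrev htorC
  -- forward envelope on ideals
  obtain ⟨n, henv⟩ :=
    exists_span_pow_mul_heegnerCharIdeal_le_stabilizedHeegnerCharIdeal_of_pow_smul_le D F C 0 hfwd' htorF
  refine ⟨D, F, X, m * 2 + n * 2, hFDt, hFβ, hSfin, hS1, htorF, ?_⟩
  calc Ideal.span {((p : IwasawaAlgebra p) ^ (m * 2 + n * 2))} * heegnerCharIdeal D F ^ 2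
      = Ideal.span {((p : IwasawaAlgebra p) ^ (m * 2))} *
          (Ideal.span {((p : IwasawaAlgebra p) ^ n)} * heegnerCharIdeal D F) ^ 2 := by
        rw [span_singleton_mul_sq, ← pow_mul, ← pow_add]
    _ ≤ Ideal.span {((p : IwasawaAlgebra p) ^ (m * 2))} * stabilizedHeegnerCharIdeal D C ^ 2 :=
        Ideal.mul_mono_right (Ideal.pow_right_mono henv 2)
    _ ≤ _ := hm

/-- **THE PARITY-FREE UNTIED HOWARD CONTAINMENT from Cornut–Vatsal Thm. 1.10 and Thm. 6.5.2's conclusion at the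
frame**: `∃ D F X, I(ℋ_∞(F))² ⊆ char_Λ(X_{Λ-tors})`, by the μ-blind promotion
`PrintX9Rescaling.howardContainment_of_localized_family` (`F := p^m • F₀`; tower input «`E(K_n)[p] = 0`» from (h1),
non-torsion element of `ℋ_∞(F₀)` by rank bookkeeping) on the localized package above. Hypotheses field by field; no
`Odd d_K`. NOT route currency (PIN-1 / R0: the `F` produced is a rescaled family).
[cite: CornutVatsal2007, Thm. 1.10] [cite: CastellaGrossiSkinner2025, Thm. 6.5.2]
[cite: Howard2004HeegnerKolyvagin, §1 ("Fixing a modular parametrization"), Thm. B] [cite: PerrinRiou1987BSMF, §1 p. 405] -/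
theorem howardContainment_untied_of_thm110_of_cgs652At
    (hCV : CornutVatsal2007.thm110_exists_heegnerCharSum_ne_zero)
    {W : WeierstrassCurve ℚ} [W.IsElliptic] [W.IsGloballyMinimal] [NeZero (W.conductorNorm ℤ)] {p : ℕ} [Fact p.Prime]
    {K : Type} [Field K] [NumberField K] {κ : ZpExtension K p} {γ : Field.absoluteGaloisGroup K}
    (hp2 : p ≠ 2) (hord : IsOrdinaryAt W p) (hpN : ¬ p ∣ W.conductorNorm ℤ)
    (hK : IsImaginaryQuadratic K) (hlt : NumberField.discr K < -4)
    (hHN : SatisfiesHeegnerHypothesis (W.conductorNorm ℤ) K) (hHp : SatisfiesHeegnerHypothesis p K)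
    (hE : ∀ Q : (W.baseChange K).toAffine.Point, p • Q = 0 → Q = 0)
    (hκ : κ.IsAnticyclotomic) (hγ : κ.IsTopGenerator γ) (jbar : AlgebraicClosure K →+* ℂ)
    (Dt : ModularParametrizationData W (W.conductorNorm ℤ)) (H : HeegnerDatum (W.conductorNorm ℤ) (NumberField.discr K))
    (h652At : ∀ (D : (W.baseChange K).LambdaAdicSelmerData κ γ)
      (C : StabilizedHeegnerData (W.conductorNorm ℤ) W K κ jbar) (X : (W.baseChange K).SelmerDualData κ γ),
      (Module.Finite (IwasawaAlgebra p) D.S ∧ Module.finrank (IwasawaAlgebra p) D.S = 1) ∧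
      (Module.Finite (IwasawaAlgebra p) X.X ∧ Module.finrank (IwasawaAlgebra p) X.X = 1 ∧
        ∃ (J : Ideal (IwasawaAlgebra p)) (m : ℕ),
          Module.charIdeal (IwasawaAlgebra p) (Submodule.torsion (IwasawaAlgebra p) X.X) = J ^ 2 ∧
          J ∣ Ideal.span {(p : IwasawaAlgebra p) ^ m} * stabilizedHeegnerCharIdeal D C)) :
    ∃ (D : (W.baseChange K).LambdaAdicSelmerData κ γ) (F : HeegnerFamily (W.conductorNorm ℤ) W K κ jbar)
      (X : (W.baseChange K).SelmerDualData κ γ),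
      heegnerCharIdeal D F ^ 2 ≤
        Module.charIdeal (IwasawaAlgebra p) (Submodule.torsion (IwasawaAlgebra p) X.X) := by
  obtain ⟨D, F₀, X, m, -, -, hSfin, hS1, htorF, hm⟩ :=
    howardContainment_untied_localized_of_thm110_of_cgs652At hCV hp2 hord hpN hK hlt hHN hHp hE hκ hγ jbar Dt H h652At
  haveI : Module.Finite (IwasawaAlgebra p) D.S := hSfin
  obtain ⟨F, hF⟩ := PrintX9Rescaling.howardContainment_of_localized_family D X F₀ m hSfin
    (fun n P hP hpP ↦ PrintX9Rescaling.fixedGeomPoints_eq_zero_of_smul_eq_zero_of_noPTorsion (W.baseChange K) κ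
      hE n hP hpP)
    htorF (PrintX9Rescaling.exists_nonTorsion_mem_of_finrank_eq_one hS1 (heegnerModule D F₀) htorF) hm
  exact ⟨D, F, X, hF⟩

/-! ## §2 On an ARBITRARY X10b Heegner frame of the crux (binders of 23729; odd or even `d_K`, any class number) -/

/-- **The untied containment on ANY X10b Heegner frame of 23729, for a given `jbar`, from Cornut–Vatsal Thm. 1.10 and
Thm. 6.5.2's conclusion at the frame.** The fields of §1 are THEOREMS on class X10b: `p = 3 ≠ 2` good ordinary
(`ClassX10.ne_two`, `.isOrdinaryAt`), `p ∤ N_E` (`.not_dvd_conductorNorm`), (h1) `E(K)[3] = 0`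
(`X10.noPTorsion_baseChange_of_classX10`: `E[3]` irreducible over `ℚ` has no `G_K`-stable line for `[K:ℚ] = 2`), and
`d_K < -4` (§0, from `d_K ≠ -3, -4`). NO parity of `d_K`, NO class number, NO `¬ Surj`/`¬ CM` is used.
[cite: CornutVatsal2007, Thm. 1.10] [cite: CastellaGrossiSkinner2025, Thm. 6.5.2]
[cite: CastellaGrossiLeeSkinner2022, §3.2 (h1)] -/
theorem howardContainmentAnyClassNumberX10b_at_of_thm110_of_cgs652At
    (hCV : CornutVatsal2007.thm110_exists_heegnerCharSum_ne_zero)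
    {W : WeierstrassCurve ℚ} [W.IsElliptic] [W.IsGloballyMinimal] {p : ℕ} [Fact p.Prime]
    [NeZero (W.conductorNorm ℤ)] {K : Type} [Field K] [NumberField K]
    (hX : ClassX10 W p) (hK : IsImaginaryQuadratic K) (h3 : NumberField.discr K ≠ -3) (h4 : NumberField.discr K ≠ -4)
    (hHN : SatisfiesHeegnerHypothesis (W.conductorNorm ℤ) K) (hHp : SatisfiesHeegnerHypothesis p K)
    {κ : ZpExtension K p} (hκ : κ.IsAnticyclotomic) {γ : Field.absoluteGaloisGroup K} (hγ : κ.IsTopGenerator γ)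
    (Dt : ModularParametrizationData W (W.conductorNorm ℤ))
    (H : HeegnerDatum (W.conductorNorm ℤ) (NumberField.discr K)) (jbar : AlgebraicClosure K →+* ℂ)
    (h652At : ∀ (D : (W.baseChange K).LambdaAdicSelmerData κ γ)
      (C : StabilizedHeegnerData (W.conductorNorm ℤ) W K κ jbar) (X : (W.baseChange K).SelmerDualData κ γ),
      (Module.Finite (IwasawaAlgebra p) D.S ∧ Module.finrank (IwasawaAlgebra p) D.S = 1) ∧
      (Module.Finite (IwasawaAlgebra p) X.X ∧ Module.finrank (IwasawaAlgebra p) X.X = 1 ∧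
        ∃ (J : Ideal (IwasawaAlgebra p)) (m : ℕ),
          Module.charIdeal (IwasawaAlgebra p) (Submodule.torsion (IwasawaAlgebra p) X.X) = J ^ 2 ∧
          J ∣ Ideal.span {(p : IwasawaAlgebra p) ^ m} * stabilizedHeegnerCharIdeal D C)) :
    ∃ (D : (W.baseChange K).LambdaAdicSelmerData κ γ) (F : HeegnerFamily (W.conductorNorm ℤ) W K κ jbar)
      (X : (W.baseChange K).SelmerDualData κ γ),
      heegnerCharIdeal D F ^ 2 ≤
        Module.charIdeal (IwasawaAlgebra p) (Submodule.torsion (IwasawaAlgebra p) X.X) :=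
  howardContainment_untied_of_thm110_of_cgs652At hCV hX.ne_two hX.isOrdinaryAt hX.not_dvd_conductorNorm hK
    (discr_lt_neg_four_of_ne hK h3 h4) hHN hHp
    (Summit.BirchSwinnertonDyer.BirchSwinnertonDyer.Rank1Residual.X10.noPTorsion_baseChange_of_classX10 hX hK.1)
    hκ hγ jbar Dt H h652At

/-! ## §3 The census: 23729 BY NAME ⟸ Cornut–Vatsal Thm. 1.10 + «Thm. 6.5.2's conclusion on the crux's frames» -/

/-- **CENSUS I — skeleton v2's residual stub `R_even` (`Stmt.stub_evenDisc_divisibleClassNumber` of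
`Cruxes/HowardContainmentAnyClassNumberX10b/Lines/torsion_depth_x10b.lean`, text VERBATIM) from Cornut–Vatsal Thm. 1.10
and «Thm. 6.5.2 (i)–(ii) on the `R_even` frames» (binders of the stub verbatim incl. `¬ Odd d_K`, `p ∣ h_K`, then
`∀ jbar D C X`, body of the typed fact).** Served CONDITIONALLY (helper, not stub credit): the residual of the line is
now ONE printed theorem's conclusion on the even-`d_K`, `3 ∣ h_K` X10b frames. [cite: CornutVatsal2007, Thm. 1.10]
[cite: CastellaGrossiSkinner2025, Thm. 6.5.2] [cite: CastellaGrossiLeeSkinner2022, §4.1 standing (disc)] -/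
theorem stub_evenDisc_divisibleClassNumber_of_thm110_of_cgs652OnEvenFrames
    (hCV : CornutVatsal2007.thm110_exists_heegnerCharSum_ne_zero)
    (hCGSE : ∀ (W : WeierstrassCurve ℚ) [W.IsElliptic] [W.IsGloballyMinimal] (p : ℕ) [Fact p.Prime]
      [NeZero (W.conductorNorm ℤ)] (K : Type) [Field K] [NumberField K],
      ClassX10 W p → ¬ Surj W 3 → ¬ W.HasCM →
      IsImaginaryQuadratic K → NumberField.discr K ≠ -3 → NumberField.discr K ≠ -4 →
      SatisfiesHeegnerHypothesis (W.conductorNorm ℤ) K → SatisfiesHeegnerHypothesis p K →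
      ∀ (κ : ZpExtension K p), κ.IsAnticyclotomic → ∀ (γ : Field.absoluteGaloisGroup K),
      κ.IsTopGenerator γ →
      ¬ Odd (NumberField.discr K) → p ∣ NumberField.classNumber K →
      ∀ (jbar : AlgebraicClosure K →+* ℂ) (D : (W.baseChange K).LambdaAdicSelmerData κ γ)
        (C : StabilizedHeegnerData (W.conductorNorm ℤ) W K κ jbar) (X : (W.baseChange K).SelmerDualData κ γ),
      (Module.Finite (IwasawaAlgebra p) D.S ∧ Module.finrank (IwasawaAlgebra p) D.S = 1) ∧
      (Module.Finite (IwasawaAlgebra p) X.X ∧ Module.finrank (IwasawaAlgebra p) X.X = 1 ∧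
        ∃ (J : Ideal (IwasawaAlgebra p)) (m : ℕ),
          Module.charIdeal (IwasawaAlgebra p) (Submodule.torsion (IwasawaAlgebra p) X.X) = J ^ 2 ∧
          J ∣ Ideal.span {(p : IwasawaAlgebra p) ^ m} * stabilizedHeegnerCharIdeal D C)) :
    ∀ (W : WeierstrassCurve ℚ) [W.IsElliptic] [W.IsGloballyMinimal] (p : ℕ) [Fact p.Prime]
      [NeZero (W.conductorNorm ℤ)] (K : Type) [Field K] [NumberField K],
      ClassX10 W p → ¬ Surj W 3 → ¬ W.HasCM →
      IsImaginaryQuadratic K → NumberField.discr K ≠ -3 → NumberField.discr K ≠ -4 →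
      SatisfiesHeegnerHypothesis (W.conductorNorm ℤ) K → SatisfiesHeegnerHypothesis p K →
      ∀ (κ : ZpExtension K p), κ.IsAnticyclotomic → ∀ (γ : Field.absoluteGaloisGroup K),
      κ.IsTopGenerator γ →
      ∀ (Dt : ModularParametrizationData W (W.conductorNorm ℤ))
        (H : HeegnerDatum (W.conductorNorm ℤ) (NumberField.discr K)) (ιC : K →+* ℂ),
      ¬ Odd (NumberField.discr K) → p ∣ NumberField.classNumber K →
      ∃ (jbar : AlgebraicClosure K →+* ℂ) (D : (W.baseChange K).LambdaAdicSelmerData κ γ)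
        (F : HeegnerFamily (W.conductorNorm ℤ) W K κ jbar) (X : (W.baseChange K).SelmerDualData κ γ),
        heegnerCharIdeal D F ^ 2 ≤
          Module.charIdeal (IwasawaAlgebra p) (Submodule.torsion (IwasawaAlgebra p) X.X) := by
  intro W _ _ p _ _ K _ _ hX hns hcm hK h3 h4 hHN hHp κ hκ γ hγ Dt H ιC heven hh
  letI : Algebra K ℂ := ιC.toAlgebra
  let jbar : AlgebraicClosure K →+* ℂ :=
    (IsAlgClosed.lift (R := K) (M := ℂ) (S := AlgebraicClosure K)).toRingHom
  obtain ⟨D, F, X, h⟩ := howardContainmentAnyClassNumberX10b_at_of_thm110_of_cgs652At hCV hX hK h3 h4 hHN hHp hκ hγ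
    Dt H jbar (hCGSE W p K hX hns hcm hK h3 h4 hHN hHp κ hκ γ hγ heven hh jbar)
  exact ⟨jbar, D, F, X, h⟩

/-- **Kernel check: on ODD-`d_K` X10b frames the frame-local hypothesis of CENSUS I is the typed leaf 27112**
(`CGSHowardDivisibilityPLocalized` = `thm652_stabilized_rankOne_charIdeal_torsion_dvd_pLocalized.{0}` instantiated at the
frame's `Thm413Hypotheses`, `X10.thm413Hypotheses_of_classX10`): the new hypothesis differs from typed print exactly on the
even-`d_K` frames. [cite: CastellaGrossiSkinner2025, Thm. 6.5.2] [cite: CastellaGrossiLeeSkinner2022, §3.2/§4.1 standing hypotheses] -/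
theorem cgs652OnFrames_oddDisc_of_cgs (hCGS : CGSHowardDivisibilityPLocalized)
    {W : WeierstrassCurve ℚ} [W.IsElliptic] [W.IsGloballyMinimal] {p : ℕ} [Fact p.Prime]
    [NeZero (W.conductorNorm ℤ)] {K : Type} [Field K] [NumberField K]
    (hX : ClassX10 W p) (hK : IsImaginaryQuadratic K) (h3 : NumberField.discr K ≠ -3)
    (hHN : SatisfiesHeegnerHypothesis (W.conductorNorm ℤ) K) (hHp : SatisfiesHeegnerHypothesis p K)
    (hodd : Odd (NumberField.discr K)) {κ : ZpExtension K p} (hκ : κ.IsAnticyclotomic)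
    {γ : Field.absoluteGaloisGroup K} (hγ : κ.IsTopGenerator γ) (jbar : AlgebraicClosure K →+* ℂ)
    (D : (W.baseChange K).LambdaAdicSelmerData κ γ) (C : StabilizedHeegnerData (W.conductorNorm ℤ) W K κ jbar)
    (X : (W.baseChange K).SelmerDualData κ γ) :
    (Module.Finite (IwasawaAlgebra p) D.S ∧ Module.finrank (IwasawaAlgebra p) D.S = 1) ∧
      (Module.Finite (IwasawaAlgebra p) X.X ∧ Module.finrank (IwasawaAlgebra p) X.X = 1 ∧
        ∃ (J : Ideal (IwasawaAlgebra p)) (m : ℕ),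
          Module.charIdeal (IwasawaAlgebra p) (Submodule.torsion (IwasawaAlgebra p) X.X) = J ^ 2 ∧
          J ∣ Ideal.span {(p : IwasawaAlgebra p) ^ m} * stabilizedHeegnerCharIdeal D C) := by
  have h652 : CastellaGrossiSkinner2025.thm652_stabilized_rankOne_charIdeal_torsion_dvd_pLocalized.{0} := hCGS
  exact h652 (W.conductorNorm ℤ) W K p κ γ jbar
    (Summit.BirchSwinnertonDyer.BirchSwinnertonDyer.Rank1Residual.X10.thm413Hypotheses_of_classX10 hX hK h3 hHN hHp
      hodd hκ hγ) D C X

/-- **CENSUS II — `HowardContainmentAnyClassNumberX10b` (23729) BY NAME ⟸ the typed leaves `CGSHowardDivisibilityPLocalized`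
(27112) and `MastellaZermanHowardDivisibility` (25233) + Cornut–Vatsal Thm. 1.10 (`hCV`) + «Thm. 6.5.2 (i)–(ii) on the
`R_even` frames» (`hCGSE`, the hypothesis of CENSUS I).** Odd `d_K` ↦ the leaf 27112 itself (`cgs652OnFrames_oddDisc_of_cgs`)
through the parity-free core; even `d_K`, `3 ∤ h_K` ↦ MZ26 Cor. 4.6 (`X10.heegnerContainment_of_cor46_of_not_surj`, no
parity hypothesis); even `d_K`, `3 ∣ h_K` ↦ CENSUS I. = p690868's census with the Kolyvagin-system leaf 23236 replaced by
Cornut–Vatsal and `R_even` replaced by ONE printed theorem's conclusion on the `R_even` frames. CONDITIONAL; credits nothing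
by itself. [cite: CastellaGrossiSkinner2025, Thm. 6.5.2 and §6 standing hypotheses] [cite: MastellaZerman2026, Cor. 4.6]
[cite: CornutVatsal2007, Thm. 1.10] [cite: CastellaGrossiLeeSkinner2022, §4.1 standing (disc) (arXiv:2008.02571v2 TeX L248–249)] -/
theorem howardContainmentAnyClassNumberX10b_of_cgs_mz_of_thm110_of_cgs652OnEvenFrames
    (hCGS : CGSHowardDivisibilityPLocalized) (hMZ : MastellaZermanHowardDivisibility)
    (hCV : CornutVatsal2007.thm110_exists_heegnerCharSum_ne_zero)
    (hCGSE : ∀ (W : WeierstrassCurve ℚ) [W.IsElliptic] [W.IsGloballyMinimal] (p : ℕ) [Fact p.Prime]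
      [NeZero (W.conductorNorm ℤ)] (K : Type) [Field K] [NumberField K],
      ClassX10 W p → ¬ Surj W 3 → ¬ W.HasCM →
      IsImaginaryQuadratic K → NumberField.discr K ≠ -3 → NumberField.discr K ≠ -4 →
      SatisfiesHeegnerHypothesis (W.conductorNorm ℤ) K → SatisfiesHeegnerHypothesis p K →
      ∀ (κ : ZpExtension K p), κ.IsAnticyclotomic → ∀ (γ : Field.absoluteGaloisGroup K),
      κ.IsTopGenerator γ →
      ¬ Odd (NumberField.discr K) → p ∣ NumberField.classNumber K →
      ∀ (jbar : AlgebraicClosure K →+* ℂ) (D : (W.baseChange K).LambdaAdicSelmerData κ γ)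
        (C : StabilizedHeegnerData (W.conductorNorm ℤ) W K κ jbar) (X : (W.baseChange K).SelmerDualData κ γ),
      (Module.Finite (IwasawaAlgebra p) D.S ∧ Module.finrank (IwasawaAlgebra p) D.S = 1) ∧
      (Module.Finite (IwasawaAlgebra p) X.X ∧ Module.finrank (IwasawaAlgebra p) X.X = 1 ∧
        ∃ (J : Ideal (IwasawaAlgebra p)) (m : ℕ),
          Module.charIdeal (IwasawaAlgebra p) (Submodule.torsion (IwasawaAlgebra p) X.X) = J ^ 2 ∧
          J ∣ Ideal.span {(p : IwasawaAlgebra p) ^ m} * stabilizedHeegnerCharIdeal D C)) :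
    HowardContainmentAnyClassNumberX10b := by
  intro W _ _ p _ _ K _ _ hX hns hcm hK h3 h4 hHN hHp κ hκ γ hγ Dt H ιC
  by_cases hodd : Odd (NumberField.discr K)
  · letI : Algebra K ℂ := ιC.toAlgebra
    let jbar : AlgebraicClosure K →+* ℂ :=
      (IsAlgClosed.lift (R := K) (M := ℂ) (S := AlgebraicClosure K)).toRingHom
    obtain ⟨D, F, X, h⟩ := howardContainmentAnyClassNumberX10b_at_of_thm110_of_cgs652At hCV hX hK h3 h4 hHN hHp hκ hγ
      Dt H jbar (fun D C X ↦ cgs652OnFrames_oddDisc_of_cgs hCGS hX hK h3 hHN hHp hodd hκ hγ jbar D C X)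
    exact ⟨jbar, D, F, X, h⟩
  · by_cases hh : p ∣ NumberField.classNumber K
    · exact stub_evenDisc_divisibleClassNumber_of_thm110_of_cgs652OnEvenFrames hCV hCGSE W p K hX hns hcm hK h3 h4 hHN
        hHp κ hκ γ hγ Dt H ιC hodd hh
    · have h46 : MastellaZerman2026.cor46_howardDivisibility_of_scalarImage.{0} := hMZ
      exact Summit.BirchSwinnertonDyer.BirchSwinnertonDyer.Rank1Residual.X10.heegnerContainment_of_cor46_of_not_surj h46
        hX hns hcm hK h3 h4 hHN hHp hh κ hκ γ hγ Dt H ιC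

end Summit.BirchSwinnertonDyer.BirchSwinnertonDyer.Theorems.PrintX10bEvenDiscOfCornutVatsal

end
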